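import Mathlib
import Summits.Ventures.PercRepro2.Defs
import Summits.Ventures.PercRepro2.Graph
import Summits.Ventures.PercRepro2.Harris
import Summits.Ventures.PercRepro2.Events
import Summits.Ventures.PercRepro2.Induced
import Summits.Ventures.PercRepro2.HullTree
import Summits.Ventures.PercRepro2.GateDefs
import Summits.Ventures.PercRepro2.GateShift
import Summits.Ventures.PercRepro2.GateAnatomy
import Summits.Ventures.PercRepro2.GateFrame
import Summits.Ventures.PercRepro2.GateCylinder

/-!
# The free one-sided gate on every FOREST (blind cell PercRepro2, mine-c g8; MINE-C.md §15,
proofs/MINEC-LSMGATE.md §7)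

On a forest (`Hull.IsForest ends`: injective `ends`, acyclic graph of all edges) two vertices `x, y`
are connected in a configuration `ω` iff every edge of the unique `x–y` path of the all-open graph is
open (`conn_iff_cylinder`): the open walk lifts to the all-open graph, its path is the unique one by
`IsAcyclic.path_unique`, and every edge of the path is then an open edge of `ω` (`ends` injective);
conversely the path transfers to the open graph (`Walk.transfer`). Hence `{w ∈ C(t)}` is the cylinder
of the `t–w` path, class `B` of the free gate is `cylinder P ∩ R′`, and `GateCylinder.gateRow_of_cylinder`
gives `covB ≥ 0` (if `t` and `w` are not joined at all, class `B` is empty). Together with the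
class-wise reduction `gateRow_of_covC_nonneg` (`0 ≤ covA → 0 ≤ covB → GateRow`, which needs NO
positivity of the classes: each class contributes `E_C` with `P(C)·E_C = r² covC + shiftC ≥ 0`,
the shift products being the `GateShift` theorems) this yields **`gateRow_of_isForest`**: the free
one-sided gate `Gate.GateRow s {t} a b {u} {w}` holds on every forest, for all positions of
`s, t, a, b, u, w` and all admissible weights, unconditionally.
-/

namespace Summit.Ventures.PercRepro2

namespace GateForest

variable {V : Type*} {E : Type*} [Fintype E] [DecidableEq E] [Fintype V] [DecidableEq V]

/-- The edges of `ends` lying on a walk of the all-open graph. -/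
def edgeFinset (ends : E → Sym2 V) {x y : V}
    (q : (openGraph ends (fun _ => true)).Walk x y) : Finset E :=
  Finset.univ.filter fun e => ends e ∈ q.edges

omit [DecidableEq E] [Fintype V] in
/-- Membership in `edgeFinset`. -/
lemma mem_edgeFinset {ends : E → Sym2 V} {x y : V}
    {q : (openGraph ends (fun _ => true)).Walk x y} {e : E} :
    e ∈ edgeFinset ends q ↔ ends e ∈ q.edges := by
  simp [edgeFinset]

omit [DecidableEq E] [Fintype V] in
/-- **On a forest, connection is the cylinder of the unique path**: for a path `q` of the all-open
graph from `x` to `y`, `x ↔ y` in `ω` iff every edge of `q` is open in `ω`. -/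
theorem conn_iff_cylinder {ends : E → Sym2 V} (hF : Hull.IsForest ends) {x y : V}
    (q : (openGraph ends (fun _ => true)).Path x y) (ω : Config E) :
    Conn ends ω x y ↔ ω ∈ GateCylinder.cylinder (edgeFinset ends q.1) := by
  constructor
  · rintro ⟨wω⟩ e he
    rw [mem_edgeFinset] at he
    -- lift to the all-open graph; its path is `q` by uniqueness
    have hle : openGraph ends ω ≤ openGraph ends (fun _ => true) :=
      openGraph_mono (Hull.le_allOpen ω)
    set wall := wω.mapLe hle with hwall
    have huniq := hF.2.path_unique wall.toPath q
    have hedges : (q : (openGraph ends (fun _ => true)).Walk x y).edges ⊆ wω.edges := by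
      rw [← huniq]
      intro f hf
      have h1 := SimpleGraph.Walk.edges_toPath_subset_edges wall hf
      rwa [hwall, SimpleGraph.Walk.edges_mapLe_eq_edges] at h1
    have hmem : ends e ∈ wω.edges := hedges he
    -- the edge `ends e = s(a, b)` is an open adjacency of `ω`
    obtain ⟨⟨a, b⟩, hab⟩ := Quot.exists_rep (ends e)
    have hab' : ends e = s(a, b) := hab.symm
    rw [hab'] at hmem
    have hadj := wω.adj_of_mem_edges hmem
    obtain ⟨_, e', he', hends'⟩ := openGraph_adj.1 hadj
    have : e' = e := hF.1 (hends'.trans hab'.symm)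
    rw [← this]
    exact he'
  · intro h
    -- transfer the path to the open graph of `ω`
    have htr : ∀ f ∈ (q : (openGraph ends (fun _ => true)).Walk x y).edges,
        f ∈ (openGraph ends ω).edgeSet := by
      intro f hf
      induction f using Sym2.ind with
      | h a b =>
        have hadj := (q : (openGraph ends (fun _ => true)).Walk x y).adj_of_mem_edges hf
        obtain ⟨hne, e', _, hends'⟩ := openGraph_adj.1 hadj
        have he' : e' ∈ edgeFinset ends q.1 := by
          rw [mem_edgeFinset, hends']; exact hf
        have hopen : ω e' = true := h e' he'
        rw [SimpleGraph.mem_edgeSet, openGraph_adj]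
        exact ⟨hne, e', hopen, hends'⟩
    exact ⟨(q : (openGraph ends (fun _ => true)).Walk x y).transfer (openGraph ends ω) htr⟩

variable {R : Type*} [Field R] [LinearOrder R] [IsStrictOrderedRing R]

/-! ## The class-wise reduction without positivity hypotheses -/

section Classes

variable (p : E → R) (ends : E → Sym2 V) (s t a b u w : V)

/-- The cleared contribution of a class `C` to the gate expression:
`E_C = r² P(XY; C) − r (x P(Y; C) + y P(X; C)) + x y P(C)`. -/
noncomputable def classExpr (C : Set (Config E)) : R :=
  prob p (avoidAll ends s {t}) ^ 2 * prob p (connAll ends s ({a} ∪ {b}) ∩ C) -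
    prob p (avoidAll ends s {t}) *
      (prob p (connAll ends s {a} ∩ avoidAll ends s {t}) * prob p (connAll ends s {b} ∩ C) +
        prob p (connAll ends s {b} ∩ avoidAll ends s {t}) * prob p (connAll ends s {a} ∩ C)) +
    prob p (connAll ends s {a} ∩ avoidAll ends s {t}) * prob p (connAll ends s {b} ∩ avoidAll ends s {t}) *
      prob p C

omit [LinearOrder R] [IsStrictOrderedRing R] in
/-- The gate expression is the sum of the two class contributions. -/
lemma gateExpr_eq_add :
    GateAnatomy.gateExpr p ends s t a b u w =
      classExpr p ends s t a b (GateAnatomy.classA ends s t w) +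
        classExpr p ends s t a b (GateAnatomy.classB ends s t u w) := by
  unfold GateAnatomy.gateExpr classExpr
  rw [GateAnatomy.prob_inter_gate, GateAnatomy.prob_inter_gate, GateAnatomy.prob_inter_gate,
    GateAnatomy.prob_gate]
  ring

omit [Fintype V] [LinearOrder R] [IsStrictOrderedRing R] in
/-- `P(C) · E_C = r² covC + shiftC`. -/
lemma mul_classExpr (C : Set (Config E)) :
    prob p C * classExpr p ends s t a b C =
      prob p (avoidAll ends s {t}) ^ 2 * GateAnatomy.covC p ends s a b C +
        GateAnatomy.shiftC p ends s t a b C := by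
  unfold classExpr GateAnatomy.covC GateAnatomy.shiftC
  ring

omit [Fintype V] in
/-- A class of zero mass contributes zero. -/
lemma classExpr_eq_zero_of_prob_eq_zero (hp : IsProbVec p) (C : Set (Config E)) (hC : prob p C = 0) :
    classExpr p ends s t a b C = 0 := by
  have h1 : prob p (connAll ends s ({a} ∪ {b}) ∩ C) = 0 :=
    le_antisymm (hC ▸ prob_mono hp Set.inter_subset_right) (prob_nonneg hp _)
  have h2 : prob p (connAll ends s {a} ∩ C) = 0 :=
    le_antisymm (hC ▸ prob_mono hp Set.inter_subset_right) (prob_nonneg hp _)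
  have h3 : prob p (connAll ends s {b} ∩ C) = 0 :=
    le_antisymm (hC ▸ prob_mono hp Set.inter_subset_right) (prob_nonneg hp _)
  unfold classExpr
  rw [h1, h2, h3, hC]
  ring

omit [Fintype V] in
/-- A class with `covC ≥ 0` and a nonnegative shift product contributes `≥ 0`. -/
lemma classExpr_nonneg (hp : IsProbVec p) (C : Set (Config E))
    (hcov : 0 ≤ GateAnatomy.covC p ends s a b C) (hshift : 0 ≤ GateAnatomy.shiftC p ends s t a b C) :
    0 ≤ classExpr p ends s t a b C := by
  rcases (prob_nonneg hp C).lt_or_eq with hpos | hzero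
  · have h := mul_classExpr p ends s t a b C
    have hr : 0 ≤ prob p (avoidAll ends s {t}) ^ 2 := sq_nonneg _
    have : 0 ≤ prob p C * classExpr p ends s t a b C := by rw [h]; positivity
    exact (mul_nonneg_iff_of_pos_left hpos).1 this
  · rw [classExpr_eq_zero_of_prob_eq_zero p ends s t a b hp C hzero.symm]

/-- **The free gate from the two class covariances** (no positivity hypotheses):
`0 ≤ covA → 0 ≤ covB → Gate.GateRow s {t} a b {u} {w}`. -/
theorem gateRow_of_covC_nonneg (hp : IsProbVec p)
    (hA : 0 ≤ GateAnatomy.covC p ends s a b (GateAnatomy.classA ends s t w))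
    (hB : 0 ≤ GateAnatomy.covC p ends s a b (GateAnatomy.classB ends s t u w)) :
    Gate.GateRow p ends s {t} a b {u} {w} := by
  rw [GateAnatomy.gateRow_iff, gateExpr_eq_add]
  have sA : 0 ≤ GateAnatomy.shiftC p ends s t a b (GateAnatomy.classA ends s t w) := by
    unfold GateAnatomy.shiftC GateAnatomy.classA
    have h1 := GateShift.shiftA_nonneg p ends s t a w hp
    have h2 := GateShift.shiftA_nonneg p ends s t b w hp
    exact mul_nonneg (by linarith) (by linarith)
  have sB : 0 ≤ GateAnatomy.shiftC p ends s t a b (GateAnatomy.classB ends s t u w) := by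
    unfold GateAnatomy.shiftC GateAnatomy.classB
    have h1 := GateShift.shiftB_nonpos p ends s t a u w hp
    have h2 := GateShift.shiftB_nonpos p ends s t b u w hp
    exact mul_nonneg_of_nonpos_of_nonpos (by linarith) (by linarith)
  exact add_nonneg (classExpr_nonneg p ends s t a b hp _ hA sA) (classExpr_nonneg p ends s t a b hp _ hB sB)

end Classes

omit [DecidableEq E] [Fintype V] in
/-- On a forest class `B` is the cylinder of the `t–w` path intersected with `R′`. -/
lemma classB_eq_cylinder {ends : E → Sym2 V} (hF : Hull.IsForest ends) (s t u w : V)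
    (q : (openGraph ends (fun _ => true)).Path t w) :
    GateAnatomy.classB ends s t u w =
      GateCylinder.cylinder (edgeFinset ends q.1) ∩ avoidAll ends s ({t} ∪ {u}) := by
  unfold GateAnatomy.classB
  congr 1
  ext ω
  simp only [clusterInEvent, cluster, Set.mem_setOf_eq]
  exact conn_iff_cylinder hF q ω

omit [Fintype E] [DecidableEq E] [Fintype V] in
/-- If `t` and `w` are not joined in the graph of all edges, class `B` is empty. -/
lemma classB_eq_empty_of_not_reachable {ends : E → Sym2 V} (s t u w : V)
    (h : ¬ (openGraph ends (fun _ => true)).Reachable t w) :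
    GateAnatomy.classB ends s t u w = ∅ := by
  ext ω
  simp only [GateAnatomy.classB, Set.mem_inter_iff, clusterInEvent, cluster, Set.mem_setOf_eq,
    Set.mem_empty_iff_false, iff_false, not_and]
  intro hc
  exact absurd (hc.mono (openGraph_mono (Hull.le_allOpen ω))) h

/-- On a forest, class `B` is positively associated: `0 ≤ covB`. -/
theorem covC_classB_nonneg_of_isForest (p : E → R) {ends : E → Sym2 V} (hF : Hull.IsForest ends)
    (s t a b u w : V) (hp : IsProbVec p) :
    0 ≤ GateAnatomy.covC p ends s a b (GateAnatomy.classB ends s t u w) := by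
  by_cases hr : (openGraph ends (fun _ => true)).Reachable t w
  · obtain ⟨wk⟩ := hr
    exact GateCylinder.covC_classB_nonneg_of_cylinder p ends s t a b u w hp
      (edgeFinset ends wk.toPath.1) (classB_eq_cylinder hF s t u w wk.toPath)
  · rw [classB_eq_empty_of_not_reachable s t u w hr]
    unfold GateAnatomy.covC
    simp [prob]

/-- **The free one-sided gate holds on every forest** (unconditional): for a forest `ends`
(`Hull.IsForest`: injective `ends`, acyclic graph of all edges) and admissible weights,
`Gate.GateRow s {t} a b {u} {w}` for all `s, t, a, b, u, w`. -/
theorem gateRow_of_isForest (p : E → R) {ends : E → Sym2 V} (hF : Hull.IsForest ends)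
    (s t a b u w : V) (hp : IsProbVec p) :
    Gate.GateRow p ends s {t} a b {u} {w} :=
  gateRow_of_covC_nonneg p ends s t a b u w hp
    (by
      unfold GateAnatomy.covC
      rw [sub_nonneg]
      have hAeq : GateAnatomy.classA ends s t w =
          avoidAll ends s {t} ∩ (Gate.hitsK ends {t} {w})ᶜ := by
        ext ω
        simp [GateAnatomy.classA, Gate.hitsK, clusterInEvent]
      rw [hAeq]
      have := Gate.hull_frame_pa p ends s {t} {w} a b hp
      linarith [this])
    (covC_classB_nonneg_of_isForest p hF s t a b u w hp)

end GateForest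

end Summit.Ventures.PercRepro2
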